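import Summits.HodgeConjecture.HodgeConjecture.Theorems.CurveNetMordellWeilCubicFourfoldNormalForm
import Summits.HodgeConjecture.HodgeConjecture.Theorems.CurveNetMordellWeilAlgebraicInNormalFormHolds
import Summits.HodgeConjecture.HodgeConjecture.Theorems.LimitExtensionHypersurfaceHodgeFourLowDegreeProof

/-!
# Route `CurveNetMordellWeil` — calibration item `CubicFourfoldNormalForm` (stmt-HodgeConjecture-18093), PROVED

THE MORDELL–WEIL NORMAL FORM ON CUBIC FOURFOLDS: on a smooth cubic fourfold `X ⊂ ℙ⁵` every rational
`(2,2)`-class is a `ℂ`-combination of Gysin images of divisor classes from smooth projective threefolds.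

Both inputs of the tree's conditional theorem `cubicFourfoldNormalForm_of_algebraicInNormalForm` (file
`CurveNetMordellWeilCubicFourfoldNormalForm`) are now theorems:
* Zucker's theorem `hodgeTwoTwo_algebraic_cubicFourfold` (the Literature named fact, file
  `HodgeTheory/CubicFourfoldHodgeConjecture`) is the degree-`3`, codimension-`2` instance of the landed
  `hypersurfaceHodgeFourLowDegree_proof` (HC for smooth hypersurface fourfolds of degree `≤ 5`, file
  `LimitExtensionHypersurfaceHodgeFourLowDegreeProof`) — discharged here as `hodgeTwoTwo_algebraic_cubicFourfold_holds`;
* `AlgebraicInNormalForm` is `curveNetMordellWeil_algebraicInNormalForm_proof` (landed p307068).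
No definition, no named-fact hypothesis, no sorry.
-/

noncomputable section

-- every declaration of this problem lives in `Summit.HodgeConjecture.HodgeConjecture.…` (summit = sub-problem)
set_option linter.dupNamespace false

namespace Summit.HodgeConjecture.HodgeConjecture.Theorems

open Literature.AlgebraicGeometry Literature.AlgebraicGeometry.HodgeTheory

/-- **Zucker's theorem, discharged** — the named fact `hodgeTwoTwo_algebraic_cubicFourfold`: every rational
`(2,2)`-class on a smooth cubic fourfold is algebraic.  Instance `d = 3`, `p = 2` of the cycle clause of
`hypersurfaceHodgeFourLowDegree_proof` (HC for smooth hypersurface fourfolds of degree `≤ 5`: Fulton's degree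
formula + spanning of top Hodge classes, both theorems of the tree).
[cite: Zucker1977, (3.2) Theorem, p. 206] [cite: ConteMurre1978, Theorem] -/
theorem hodgeTwoTwo_algebraic_cubicFourfold_holds : hodgeTwoTwo_algebraic_cubicFourfold :=
  fun _ hX c hc hpp ↦ (hypersurfaceHodgeFourLowDegree_proof (by norm_num) hX).2 2 c hc hpp

/-- **Item stmt-HodgeConjecture-18093 (`CubicFourfoldNormalForm`, route `CurveNetMordellWeil`)**: the
Mordell–Weil normal form of rational `(2,2)`-classes on smooth cubic fourfolds —
`cubicFourfoldNormalForm_of_algebraicInNormalForm` fed with Zucker's theorem (`hodgeTwoTwo_algebraic_cubicFourfold_holds`)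
and the landed `AlgebraicInNormalForm`.  The type is literally the route decl
`Summit.HodgeConjecture.HodgeConjecture.Theses.CurveNetMordellWeil.CubicFourfoldNormalForm`.
[cite: Zucker1977, (3.2) Theorem, p. 206] [cite: Murre1977, Theorem and Corollary, p. 230]
[cite: DeligneHodgeIII1974, Cor. 8.2.8] -/
theorem curveNetMordellWeil_cubicFourfoldNormalForm_proof :
    Summit.HodgeConjecture.HodgeConjecture.Theses.CurveNetMordellWeil.CubicFourfoldNormalForm :=
  cubicFourfoldNormalForm_of_algebraicInNormalForm hodgeTwoTwo_algebraic_cubicFourfold_holds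
    curveNetMordellWeil_algebraicInNormalForm_proof

end Summit.HodgeConjecture.HodgeConjecture.Theorems

end
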